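import Summits.ABC.IUTFork.Repair.RHNettingHeightExponent
import Summits.ABC.IUTFork.Repair.RHHeightScalingBarrier
import HarnessLib

/-!
# R-H ROUND-3 AXIS D2, seat D2-EXP-5 (abc-iut-rh2-L1 g14), part 2 — desk ruling R81 G4 «cumulative tier vs class increment: label which»:
# (T) the CUMULATIVE tier «EX × across» has exponent `−1` with constant `Π/M ∈ [B_lo/Dem, B/Dem]`; (I) the CLASS INCREMENT «across over within» is EXTINCT

PROOF-ONLY sequel (0 definitions, 0 `Prop` facts, no instance, no notation) of `Repair/RHNettingHeightExponent.lean` (p531669; abc-iut cell, rung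
LADDER-ABC:A2.RESCUE.H), same exact-cell model and cell law (★) `−s·A_c + P_c ≤ μ_c(s) ≤ −s·A_c + P_c + r_c` (discharged for the kernel's integer
margin there, §1/§4). Part 1 typed the FINAL's (1)(e) reading `C/R` (`s·(C/R)(s) ∈ [C_lo/Dem, 2B/Dem]`, exponent `−1`). The AXIS-D2 table
(R/ROUND3/AXIS-D2-EXPONENT-TABLE.md, assembler abc-iut-rh2-tab-1; desk INDEX R78/R80/R81) distinguishes two further readings of «across-place netting»,
both typed here:
* §1 (T) CUMULATIVE TIER. The kept fraction of the scaled mass `M(s) = s·Dem` under exact information netted across labels AND places is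
  `π_b(s) = min(1, 1 + (C(s) − R(s))/M(s))`; past the crossing the `min` is inactive and `s·π_b(s) = s + (Σ ω·μ(s))/Dem`. THEOREMS
  `priceFloor_sub_le_bill` / `bill_le_priceCeiling_sub` (the signed bill `Σ ω·μ(s)` lies in `[B_lo − s·Dem, B − s·Dem]`),
  `scale_add_bill_div_mem_Icc` and **`scale_mul_tier_mem_Icc`**: for every `s > 0`, `s·(1 + (C − R)/(s·Dem)) ∈ [B_lo/Dem, B/Dem]` — exponent
  EXACTLY `−1`, constant the HEIGHT-FREE price-over-demand bracket («ĉ = Π/M», `Π(s) := s·Dem + Σ ω·μ(s) ∈ [B_lo, B]`; bed values of record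
  ĉ = 1.891 · 3.836 · 2.005 on FREY133 · HEX79 · FREY482, assembler ENGINE C / kit-2 PASS 22b `t_lin`; saturated kind: a bracket, no `o(1)` claim).
* §2 (I) CLASS INCREMENT. `min_sum_eq_sum_min_of_le`: if every place's credit is at most its own debt then `min(Σ_w C_w, Σ_w R_w) = Σ_w min(C_w, R_w)`;
  **`acrossIncrement_eq_zero_of_placewise_priceCeiling_lt`**: once EVERY place is past its own price ceiling (`B_w < s·Dem_w`, whence `C_w(s) < R_w(s)`
  by part 1's `credit_lt_remainder_of_priceCeiling_lt`), the mass financed by netting across places EQUALS the mass financed place by place —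
  the increment of the class «across-place netting» over «within-place financing» (seat D2-EXP-3) is `≡ 0` from the extinction scale
  `s_ext ≤ max_w B_w/Dem_w` on (`placewise_priceCeiling_lt_of_lt`); an EXTINCT class in the desk's grammar (R81 G2: bracket + extinction height,
  never `c·h^e`). Bed values of record (assembler ENGINE C): increment `≡ 0` past `h` med 2,120 · 2,800 · 1,540 nats, max 1.06·10⁴ nats.
* §4 JUNCTION with abc-iut-rh2-w-2's BARRIER p531802 (`RH.HeightScalingBarrier`): `powerBoundFrom_credit` / `powerBoundFrom_financed` — the
  across-place netting object obeys `PowerBoundFrom _ 0 B 0` (mass exponent `α = 0`, ∀-certified constant `B`, onset `0`), so it enters `Barrier` BY NAME;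
  `acrossNetting_not_closedBy` — it never closes the requirement `Dem·s − tol` past `s = (B + tol)/Dem` (`not_closedBy_of_heightFree` instantiated).
* §3 `creditFloor_pos` / `labelOne_price_pos`: on a genuine tower (every bad place ramified) the credit floor `C_lo` is positive, so part 1's
  two-sided bracket makes the exponent of `C/R` EXACTLY `−1` (not merely `≤ −1`).
HONEST FRAMING: real arithmetic about OUR typed cell currency; nothing here decides any cell at genuine data, asserts or denies [IUTchIII] Cor. 3.12 /
[IUTchIV] Thm. 1.10, or bears on abc; no side taken on any author; typed ≠ proved; computed ≠ proved. [claim: Mochizuki2012, status: disputed] for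
every IUT locution. [cite: Mochizuki2012, IUTchIII Cor. 3.12 p. 173–175; IUTchIV Prop. 1.2 (i)(ii) p. 10, Thm. 1.10 p. 26–28] [cite: DupuyHilado2025, §3.7, §4.9, §4.12]
-/

noncomputable section

open Finset

namespace Summit.ABC.IUTFork.Repair.RHNettingHeightExponent

/-! ## §1. (T) The signed-bill bracket and the CUMULATIVE tier `EX × across`
— exponent `−1`, constant `Π/M ∈ [B_lo/Dem, B/Dem]` -/

section Tier

variable {ι : Type*} {S : Finset ι} {ω A P r μ : ι → ℝ} {s : ℝ}

/-- **Signed bill, lower bracket**: under the lower half of (★), `B_lo − s·Dem ≤ Σ ω_c·μ_c(s)` (`B_lo = Σ ω·P`, the price floor). [folklore] -/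
theorem priceFloor_sub_le_bill (hω : ∀ c ∈ S, 0 ≤ ω c) (hlo : ∀ c ∈ S, -(s * A c) + P c ≤ μ c) :
    ∑ c ∈ S, ω c * P c - s * ∑ c ∈ S, ω c * A c ≤ ∑ c ∈ S, ω c * μ c := by
  have h1 : ∑ c ∈ S, ω c * (-(s * A c) + P c) ≤ ∑ c ∈ S, ω c * μ c :=
    sum_le_sum fun c hc => mul_le_mul_of_nonneg_left (hlo c hc) (hω c hc)
  have h2 : ∑ c ∈ S, ω c * (-(s * A c) + P c) = ∑ c ∈ S, ω c * P c - s * ∑ c ∈ S, ω c * A c := by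
    rw [mul_sum, ← sum_sub_distrib]
    exact sum_congr rfl fun c _ => by ring
  linarith

/-- **Signed bill, upper bracket**: under the upper half of (★), `Σ ω_c·μ_c(s) ≤ B − s·Dem` (`B = Σ ω·(P + r)`, the price ceiling). [folklore] -/
theorem bill_le_priceCeiling_sub (hω : ∀ c ∈ S, 0 ≤ ω c) (hhi : ∀ c ∈ S, μ c ≤ -(s * A c) + P c + r c) :
    ∑ c ∈ S, ω c * μ c ≤ ∑ c ∈ S, ω c * (P c + r c) - s * ∑ c ∈ S, ω c * A c := by
  have h1 : ∑ c ∈ S, ω c * μ c ≤ ∑ c ∈ S, ω c * (-(s * A c) + P c + r c) :=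
    sum_le_sum fun c hc => mul_le_mul_of_nonneg_left (hhi c hc) (hω c hc)
  have h2 : ∑ c ∈ S, ω c * (-(s * A c) + P c + r c) = ∑ c ∈ S, ω c * (P c + r c) - s * ∑ c ∈ S, ω c * A c := by
    rw [mul_sum, ← sum_sub_distrib]
    exact sum_congr rfl fun c _ => by ring
  linarith

/-- **The tier constant, additive form**: `s + (Σ ω·μ(s))/Dem ∈ [B_lo/Dem, B/Dem]` for every `s` (`Dem > 0`) — height-free bracket. [folklore] -/
theorem scale_add_bill_div_mem_Icc (hω : ∀ c ∈ S, 0 ≤ ω c) (hlo : ∀ c ∈ S, -(s * A c) + P c ≤ μ c)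
    (hhi : ∀ c ∈ S, μ c ≤ -(s * A c) + P c + r c) (hDem : 0 < ∑ c ∈ S, ω c * A c) :
    s + (∑ c ∈ S, ω c * μ c) / (∑ c ∈ S, ω c * A c) ∈
      Set.Icc ((∑ c ∈ S, ω c * P c) / ∑ c ∈ S, ω c * A c) ((∑ c ∈ S, ω c * (P c + r c)) / ∑ c ∈ S, ω c * A c) := by
  set Dm := ∑ c ∈ S, ω c * A c with hDm
  have hlo' : ∑ c ∈ S, ω c * P c - s * Dm ≤ ∑ c ∈ S, ω c * μ c := priceFloor_sub_le_bill hω hlo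
  have hhi' : ∑ c ∈ S, ω c * μ c ≤ ∑ c ∈ S, ω c * (P c + r c) - s * Dm := bill_le_priceCeiling_sub hω hhi
  have key : (s + (∑ c ∈ S, ω c * μ c) / Dm) * Dm = s * Dm + ∑ c ∈ S, ω c * μ c := by
    field_simp
  constructor
  · rw [div_le_iff₀ hDem, key]
    linarith
  · rw [le_div_iff₀ hDem, key]
    linarith

/-- **THE CUMULATIVE TIER «EX × ACROSS» HAS EXPONENT `−1` WITH CONSTANT `Π/M ∈ [B_lo/Dem, B/Dem]`.** The kept fraction of the scaled mass
`M(s) = s·Dem` under exact information netted across labels AND places is `π_b(s) = 1 + (C(s) − R(s))/M(s)` (the bed's `min(1, ·)` is inactive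
beyond the crossing); by `credit_sub_remainder_eq` and the bill bracket, `s·π_b(s) = s + (Σ ω·μ)/Dem ∈ [B_lo/Dem, B/Dem]` for EVERY `s > 0` —
a HEIGHT-FREE bracket (the desk's «ĉ = Π/M»), exponent exactly `−1`, saturated kind (bracket, no `o(1)` claim). [folklore] -/
theorem scale_mul_tier_mem_Icc (hω : ∀ c ∈ S, 0 ≤ ω c) (hs : 0 < s) (hlo : ∀ c ∈ S, -(s * A c) + P c ≤ μ c)
    (hhi : ∀ c ∈ S, μ c ≤ -(s * A c) + P c + r c) (hDem : 0 < ∑ c ∈ S, ω c * A c) :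
    s * (1 + (∑ c ∈ S, ω c * max (μ c) 0 - ∑ c ∈ S, ω c * max (-μ c) 0) / (s * ∑ c ∈ S, ω c * A c)) ∈
      Set.Icc ((∑ c ∈ S, ω c * P c) / ∑ c ∈ S, ω c * A c) ((∑ c ∈ S, ω c * (P c + r c)) / ∑ c ∈ S, ω c * A c) := by
  rw [credit_sub_remainder_eq]
  have hs0 : s ≠ 0 := hs.ne'
  have hD0 : (∑ c ∈ S, ω c * A c) ≠ 0 := hDem.ne'
  have key : s * (1 + (∑ c ∈ S, ω c * μ c) / (s * ∑ c ∈ S, ω c * A c)) =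
      s + (∑ c ∈ S, ω c * μ c) / (∑ c ∈ S, ω c * A c) := by
    field_simp
  rw [key]
  exact scale_add_bill_div_mem_Icc hω hlo hhi hDem

end Tier

/-! ## §2. (I) The CLASS INCREMENT «across over within» is EXTINCT — once every place's own debt exceeds its own credit, pooling across
places finances nothing more than place-by-place financing -/

section Increment

variable {κ ι : Type*} {W : Finset κ} {T : κ → Finset ι} {ω A P r μ : ι → ℝ} {s : ℝ}

/-- **Pooling identity**: if every place's credit is at most its own debt, `min(Σ_w C_w, Σ_w R_w) = Σ_w min(C_w, R_w)` (both `= Σ_w C_w`):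
the across-place gain over within-place financing is ZERO. [folklore] -/
theorem min_sum_eq_sum_min_of_le {Cw Rw : κ → ℝ} (h : ∀ w ∈ W, Cw w ≤ Rw w) :
    min (∑ w ∈ W, Cw w) (∑ w ∈ W, Rw w) = ∑ w ∈ W, min (Cw w) (Rw w) := by
  have h1 : ∑ w ∈ W, min (Cw w) (Rw w) = ∑ w ∈ W, Cw w := sum_congr rfl fun w hw => min_eq_left (h w hw)
  rw [h1, min_eq_left (sum_le_sum h)]

/-- **EXTINCTION OF THE ACROSS-PLACE INCREMENT.** Cells grouped by place (`T w` the cells of place `w`), cell law (★) upper half, weights `ω ≥ 0`;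
if at the height scale `s` EVERY place is past its own price ceiling, `B_w < s·Dem_w` (so `C_w(s) < R_w(s)` by `credit_lt_remainder_of_priceCeiling_lt`),
then the mass financed by netting across places equals the mass financed place by place:
`min(Σ_w C_w(s), Σ_w R_w(s)) = Σ_w min(C_w(s), R_w(s))` — the class increment is `≡ 0` from `s_ext ≤ max_w B_w/Dem_w` on (an EXTINCT class:
bracket + extinction scale, no `c·h^e`). [folklore] -/
theorem acrossIncrement_eq_zero_of_placewise_priceCeiling_lt (hω : ∀ w ∈ W, ∀ c ∈ T w, 0 ≤ ω c)
    (hhi : ∀ w ∈ W, ∀ c ∈ T w, μ c ≤ -(s * A c) + P c + r c)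
    (hBs : ∀ w ∈ W, ∑ c ∈ T w, ω c * (P c + r c) < s * ∑ c ∈ T w, ω c * A c) :
    min (∑ w ∈ W, ∑ c ∈ T w, ω c * max (μ c) 0) (∑ w ∈ W, ∑ c ∈ T w, ω c * max (-μ c) 0) -
      ∑ w ∈ W, min (∑ c ∈ T w, ω c * max (μ c) 0) (∑ c ∈ T w, ω c * max (-μ c) 0) = 0 := by
  rw [sub_eq_zero]
  exact min_sum_eq_sum_min_of_le fun w hw => (credit_lt_remainder_of_priceCeiling_lt (hω w hw) (hhi w hw) (hBs w hw)).le

/-- **A sufficient extinction scale**: if `s·Dem_w > B_w` holds as soon as `s > B_w/Dem_w` (`Dem_w > 0` at every place), then every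
`s > max_w B_w/Dem_w` — here phrased with any common bound `s₀ ≥ B_w/Dem_w ∀ w` — is past every place's ceiling. [folklore] -/
theorem placewise_priceCeiling_lt_of_lt {s₀ : ℝ} (hDem : ∀ w ∈ W, 0 < ∑ c ∈ T w, ω c * A c)
    (hs₀ : ∀ w ∈ W, (∑ c ∈ T w, ω c * (P c + r c)) / (∑ c ∈ T w, ω c * A c) ≤ s₀) (hs : s₀ < s) :
    ∀ w ∈ W, ∑ c ∈ T w, ω c * (P c + r c) < s * ∑ c ∈ T w, ω c * A c := fun w hw => by
  have h := (div_le_iff₀ (hDem w hw)).mp (hs₀ w hw)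
  calc ∑ c ∈ T w, ω c * (P c + r c) ≤ s₀ * ∑ c ∈ T w, ω c * A c := h
    _ < s * ∑ c ∈ T w, ω c * A c := mul_lt_mul_of_pos_right hs (hDem w hw)

end Increment

/-! ## §3. On genuine towers the credit floor is POSITIVE, so the exponent of (R1) is `= −1`, not `< −1` -/

section Floor

variable {ι : Type*} {S : Finset ι} {ω A P : ι → ℝ}

/-- **`C_lo > 0` as soon as ONE demand-free cell carries weight and price** — on a genuine tower every bad place is ramified (`e_w = e_v·l ≥ 2`,
so `D_w ≥ e_w − 1 ≥ 1` and the label-1 price `D_w + 2G_w ≥ 1`), hence the lower constant `C_lo/Dem` of part 1's `scale_mul_ratio_mem_Icc` is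
positive and the height exponent of `C/R` is EXACTLY `−1` (bed: `C_lo > 0` on 781/781 data). [folklore] -/
theorem creditFloor_pos [DecidablePred fun c => A c = 0] (hω : ∀ c ∈ S, 0 ≤ ω c) (hP : ∀ c ∈ S, 0 ≤ P c) {c₀ : ι} (hc₀ : c₀ ∈ S)
    (hA₀ : A c₀ = 0) (hω₀ : 0 < ω c₀) (hP₀ : 0 < P c₀) :
    0 < ∑ c ∈ S.filter (fun c => A c = 0), ω c * P c :=
  sum_pos' (fun c hc => mul_nonneg (hω c (mem_filter.mp hc).1) (hP c (mem_filter.mp hc).1))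
    ⟨c₀, mem_filter.mpr ⟨hc₀, hA₀⟩, mul_pos hω₀ hP₀⟩

/-- **Label-1 price is positive at a ramified place**: `1 ≤ D`, `R_out ≤ R_in` ⇒ `0 < 1·D + (1+1)·(R_in − R_out)`. [folklore] -/
theorem labelOne_price_pos {D Rin Rout : ℝ} (hD : 1 ≤ D) (hG : Rout ≤ Rin) : 0 < 1 * D + (1 + 1) * (Rin - Rout) := by
  nlinarith

end Floor

/-! ## §4. JUNCTION with the AXIS-D2 BARRIER (abc-iut-rh2-w-2 p531802 `RH.HeightScalingBarrier`): the across-place netting object enters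
`Barrier` BY NAME with mass exponent `α = 0` (conductor-type) and the ∀-certified constant `B` -/

section Junction

open Summit.ABC.IUTFork.Repair.RH.HeightScalingBarrier

variable {ι : Type*} {S : Finset ι} {ω A P r : ι → ℝ} {μ : ℝ → ι → ℝ}

/-- **Across-place netting CREDIT is a height-free mass law**: for a height family of margins obeying the upper half of (★) at every `s ≥ 0`,
the credit profile `s ↦ C(s)` satisfies rh2-w-2's `PowerBoundFrom _ 0 B 0` (`B = Σ ω·(P + r)`, onset `0`). [folklore] -/
theorem powerBoundFrom_credit (hω : ∀ c ∈ S, 0 ≤ ω c) (hA : ∀ c ∈ S, 0 ≤ A c) (hP : ∀ c ∈ S, 0 ≤ P c) (hr : ∀ c ∈ S, 0 ≤ r c)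
    (hhi : ∀ s : ℝ, 0 ≤ s → ∀ c ∈ S, μ s c ≤ -(s * A c) + P c + r c) :
    PowerBoundFrom (fun s => ∑ c ∈ S, ω c * max (μ s c) 0) 0 (∑ c ∈ S, ω c * (P c + r c)) 0 :=
  powerBoundFrom_zero_of_heightFree fun s hs => credit_le_priceCeiling hω hA hP hr hs (hhi s hs)

/-- **… and so is the FINANCED mass `min(C(s), R(s))`** (the desk's «mass financed by across-place netting alone»). [folklore] -/
theorem powerBoundFrom_financed (hω : ∀ c ∈ S, 0 ≤ ω c) (hA : ∀ c ∈ S, 0 ≤ A c) (hP : ∀ c ∈ S, 0 ≤ P c) (hr : ∀ c ∈ S, 0 ≤ r c)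
    (hhi : ∀ s : ℝ, 0 ≤ s → ∀ c ∈ S, μ s c ≤ -(s * A c) + P c + r c) :
    PowerBoundFrom (fun s => min (∑ c ∈ S, ω c * max (μ s c) 0) (∑ c ∈ S, ω c * max (-μ s c) 0)) 0
      (∑ c ∈ S, ω c * (P c + r c)) 0 :=
  powerBoundFrom_zero_of_heightFree fun s hs => financed_le_priceCeiling hω hA hP hr hs (hhi s hs)

/-- **THE ACROSS-PLACE NETTING OBJECT NEVER CLOSES THE REQUIREMENT PAST `(B + tol)/Dem`** (rh2-w-2's `not_closedBy_of_heightFree`, instantiated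
BY NAME on the one-object family «netting credit»): for every `s ≥ 0` with `(B + tol)/Dem < s`, `¬ ClosedBy (fun _ => C) Dem tol s` — i.e.
`Dem·s − tol ≤ C(s)` fails. With `tol = 0` this is part 1's crossing law `credit_lt_remainder_of_priceCeiling_lt` in the barrier's words.
[claim: Mochizuki2012, status: disputed] -/
theorem acrossNetting_not_closedBy (hω : ∀ c ∈ S, 0 ≤ ω c) (hA : ∀ c ∈ S, 0 ≤ A c) (hP : ∀ c ∈ S, 0 ≤ P c) (hr : ∀ c ∈ S, 0 ≤ r c)
    (hhi : ∀ s : ℝ, 0 ≤ s → ∀ c ∈ S, μ s c ≤ -(s * A c) + P c + r c) (hDem : 0 < ∑ c ∈ S, ω c * A c) {tol s : ℝ} (hs : 0 ≤ s)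
    (hcross : ((∑ _i : Fin 1, ∑ c ∈ S, ω c * (P c + r c)) + tol) / (∑ c ∈ S, ω c * A c) < s) :
    ¬ ClosedBy (fun (_ : Fin 1) (s : ℝ) => ∑ c ∈ S, ω c * max (μ s c) 0) (∑ c ∈ S, ω c * A c) tol s :=
  not_closedBy_of_heightFree (f := fun (_ : Fin 1) (s : ℝ) => ∑ c ∈ S, ω c * max (μ s c) 0)
    (C := fun _ : Fin 1 => ∑ c ∈ S, ω c * (P c + r c)) (s₁ := 0) hDem
    (fun _ s' hs' => credit_le_priceCeiling hω hA hP hr hs' (hhi s' hs')) hs hcross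

end Junction

end Summit.ABC.IUTFork.Repair.RHNettingHeightExponent

end
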